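import Summits.HubbardSuperconductivity.HubbardSuperconductivity.Theorems.SoloBlindCooperPairing
import HarnessLib

/-!
# `d`-wave long-range order for the free and the weakly repulsive crutched Hamiltonian
# (solo-blind programme, Theorems 30 and 30⁺)

**Theorem 30** (the `U = 0` book-end of the crutch axis; claim C53 of the programme): for every
doping `δ ∈ (0, 1/2)` and every coupling `g > 0`, normalised ground states of
`H₀(L) - (g/L²) Δ_d(L)ᴴ Δ_d(L)` in the summit's particle-number sectors
`(2⌊(1-δ)L²/2⌋, S^z = 0)` have `d`-wave pair long-range order in exactly the summit's sense
(`free_crutch_hasLongRangeOrder`; sides written `n + 1`, as the statement only constrains even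
`L ≥ 2`).

**Theorem 30⁺** (`weak_coupling_crutch_hasLongRangeOrder`): the same holds for the crutched
HUBBARD Hamiltonian `H_U(L) - (g/L²) Δ_dᴴ Δ_d` for every `0 ≤ U ≤ U₀(g)`, with the explicit
`U₀ = 3(J+1)/(2048π² 16^J)`, `J = ⌈8·225·2048π²/(147 g)⌉` (so `U₀ = exp(-O(1/g))`); in
quantitative form (`weak_coupling_crutch_order_ge`) every normalised sector ground state `φ` has
`re ⟨φ, Δ_dᴴΔ_d φ⟩ ≥ (U₀/g)·L⁴` for all even `L ≥ L₁(δ, g)` — the BCS essential-singularity rate.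

Mechanism: the Cooper trial state `Ψ` of Theorem 29 (depth `J ~ 1/g`) lies `κ_J L²‖Ψ‖²` below the
free sector minimum; the repulsion costs at most `U L² ‖Ψ‖²` (`0 ≤ D ≤ L²`,
`D = Σ_x n_{x↑}n_{x↓}`) and can only raise the sector minimum (`E_K(H_U) ≥ E_K(H₀)`,
`minEnergyOn_hubbardTorus_zero_le_of_nonneg`), so for `U ≤ κ_J/2` the trial state still lies
`(κ_J/2) L² ‖Ψ‖²` below `E_K(H_U)` (`exists_cooper_trial_weak`); the variational crutch principle
(Theorem 24(c), `crutch_hasLongRangeOrder_of_trials`) gives the order.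

These are theorems about the mean-field-like Hamiltonians `H_U - (g/L²)ΔᴴΔ`, not about the
Hubbard model: the region of the `(U, t)` crutch plane (`t = g/L²`) where the summit's conclusion
(order parameter, sectors, normalisation, box sequence verbatim) is PROVED is `{g ≥ g₀(U, δ)}`
(Theorem 23) together with `{0 ≤ U ≤ U₀(g)}` (this file); it touches the Hubbard axis `t = 0`
only at `U = 0`, with width `U₀(g) → 0` faster than any power of `g`.  The summit is the
statement at `t = 0`, `U > 0` fixed.  [this work]
-/

noncomputable section

namespace Summit.HubbardSuperconductivity.HubbardSuperconductivity.Theorems.CooperPairing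

open Matrix Finset Real Literature.Probability.LatticeModels
  Literature.MathematicalPhysics.QuantumLattice
  Summit.HubbardSuperconductivity.HubbardSuperconductivity.Theorems.CrutchAxis
open scoped ComplexOrder

variable {L : ℕ} [NeZero L]

/-- `re ⟨v, (H + c•O) v⟩ = re ⟨v, H v⟩ + c · re ⟨v, O v⟩` for real `c` (private: folklore,
stated elsewhere in the tree). -/
private theorem re_rayleigh_add_ofReal_smul₃ {ι : Type*} [Fintype ι] (H O : Matrix ι ι ℂ)
    (c : ℝ) (v : ι → ℂ) :
    (star v ⬝ᵥ (H + (c : ℂ) • O) *ᵥ v).re =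
      (star v ⬝ᵥ H *ᵥ v).re + c * (star v ⬝ᵥ O *ᵥ v).re := by
  rw [add_mulVec, smul_mulVec, dotProduct_add, dotProduct_smul, Complex.add_re, smul_eq_mul,
    Complex.re_ofReal_mul]

omit [NeZero L] in
/-- **Monotonicity of the sector minimum in the repulsion**: for `U ≥ 0` and a sector `K`
containing a nonzero vector, `E_K(H₀) ≤ E_K(H_U)` (`H_U = H₀ + U·D` with `D ≥ 0`). [folklore] -/
theorem minEnergyOn_hubbardTorus_zero_le_of_nonneg {U : ℝ} (hU : 0 ≤ U)
    (K : Submodule ℂ (Fock (Orb (FermionTorus 2 L)))) {Ψ : Fock (Orb (FermionTorus 2 L))}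
    (hΨK : Ψ ∈ K) (hΨ0 : Ψ ≠ 0) :
    (hubbardTorus 2 L 1 0).minEnergyOn K ≤ (hubbardTorus 2 L 1 U).minEnergyOn K := by
  obtain ⟨c, -, -, hc1⟩ := EigenvalueContinuation.exists_normalize hΨ0
  have hne : {E : ℝ | ∃ ψ ∈ K, star ψ ⬝ᵥ ψ = 1 ∧
      E = (star ψ ⬝ᵥ hubbardTorus 2 L 1 U *ᵥ ψ).re}.Nonempty :=
    ⟨_, (c : ℂ) • Ψ, K.smul_mem _ hΨK, hc1, rfl⟩
  refine le_csInf hne ?_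
  rintro E ⟨φ, hφK, hφ1, rfl⟩
  calc (hubbardTorus 2 L 1 0).minEnergyOn K
      ≤ (star φ ⬝ᵥ hubbardTorus 2 L 1 0 *ᵥ φ).re :=
        minEnergyOn_le_rayleigh_of_mem (isHermitian_hubbardTorus L 1 0) K hφK hφ1
    _ ≤ (star φ ⬝ᵥ hubbardTorus 2 L 1 U *ᵥ φ).re := by
        rw [hubbardTorus_eq_zero_add_smul_interaction U, re_rayleigh_add_ofReal_smul₃]
        nlinarith [(re_expect_interaction_torus_mem_Icc φ).1]

/-- **Theorem 29⁺ (Cooper trial state, weak repulsion).** Under the hypotheses of Theorem 29 and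
`0 ≤ U ≤ 3(J+1)/(2048π²16^J)`, the Cooper trial state lies `3(J+1)/(2048π²16^J)·L²·‖Ψ‖²` below the
sector minimum of the REPULSIVE `H_U` for the crutched Hamiltonian `H_U - (g/L²)Δ_dᴴΔ_d`.
[this work] -/
theorem exists_cooper_trial_weak (hL3 : 3 ≤ L) (hLe : Even L) {δ : ℝ} (hδ0 : 0 < δ)
    (hδ1 : δ < 1 / 2) (hLδ : 4 / (1 - 2 * δ) ≤ (L : ℝ) ^ 2) (J : ℕ) {g : ℝ} (hg : 0 < g)
    (hL1 : 64 * π ≤ L) (hL2 : 64 * π / 3 * 4 ^ J ≤ 1 / 2 * (L : ℝ))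
    (hL4 : 48 * 4 ^ J < 3 / (2048 * π ^ 2) * (L : ℝ) ^ 2)
    (hJ : 8 ≤ 49 * g / 225 * ((J + 1) * (3 / (2048 * π ^ 2)))) {U : ℝ} (hU0 : 0 ≤ U)
    (hU : U ≤ 3 * (J + 1) / (2048 * π ^ 2 * 16 ^ J)) :
    ∃ Ψ : Fock (Orb (FermionTorus 2 L)),
      Ψ ∈ szSector (Λ := FermionTorus 2 L) (2 * ⌊(1 - δ) * (L : ℝ) ^ 2 / 2⌋₊) 0 ∧ Ψ ≠ 0 ∧
      (star Ψ ⬝ᵥ (hubbardTorus 2 L 1 U + ((-(g / (L : ℝ) ^ 2) : ℝ) : ℂ) •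
          ((pairField dWaveFormFactor L)ᴴ * pairField dWaveFormFactor L)) *ᵥ Ψ).re ≤
        ((hubbardTorus 2 L 1 U).minEnergyOn
            (szSector (Λ := FermionTorus 2 L) (2 * ⌊(1 - δ) * (L : ℝ) ^ 2 / 2⌋₊) 0) -
          3 * (J + 1) / (2048 * π ^ 2 * 16 ^ J) * (L : ℝ) ^ 2) * (star Ψ ⬝ᵥ Ψ).re := by
  obtain ⟨Ψ, hΨK, hΨ0, hΨ⟩ := exists_cooper_trial hL3 hLe hδ0 hδ1 hLδ J hg hL1 hL2 hL4 hJ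
  refine ⟨Ψ, hΨK, hΨ0, ?_⟩
  have hmono := minEnergyOn_hubbardTorus_zero_le_of_nonneg hU0 _ hΨK hΨ0
  have hsplit : (star Ψ ⬝ᵥ (hubbardTorus 2 L 1 U + ((-(g / (L : ℝ) ^ 2) : ℝ) : ℂ) •
      ((pairField dWaveFormFactor L)ᴴ * pairField dWaveFormFactor L)) *ᵥ Ψ).re =
      (star Ψ ⬝ᵥ (hubbardTorus 2 L 1 0 + ((-(g / (L : ℝ) ^ 2) : ℝ) : ℂ) •
        ((pairField dWaveFormFactor L)ᴴ * pairField dWaveFormFactor L)) *ᵥ Ψ).re +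
      U * (star Ψ ⬝ᵥ ((∑ x : FermionTorus 2 L, numberOp x 0 * numberOp x 1 :
        Matrix (Finset (Orb (FermionTorus 2 L))) _ ℂ) *ᵥ Ψ)).re := by
    rw [hubbardTorus_eq_zero_add_smul_interaction U, add_right_comm, re_rayleigh_add_ofReal_smul₃]
  have hD := (re_expect_interaction_torus_mem_Icc Ψ).2
  have hnn : 0 ≤ (star Ψ ⬝ᵥ Ψ).re := by
    have h := (Complex.lt_def.1 (Matrix.dotProduct_star_self_pos_iff.2 hΨ0)).1
    rw [Complex.zero_re] at h
    exact h.le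
  have e : 3 * ((J : ℝ) + 1) / (1024 * π ^ 2 * 16 ^ J) =
      2 * (3 * ((J : ℝ) + 1) / (2048 * π ^ 2 * 16 ^ J)) := by
    field_simp
    ring
  rw [e] at hΨ
  have h1 := mul_le_mul_of_nonneg_right hmono hnn
  have h2 := mul_le_mul_of_nonneg_left hD hU0
  have h3 := mul_le_mul_of_nonneg_right hU (mul_nonneg (sq_nonneg (L : ℝ)) hnn)
  rw [hsplit]
  nlinarith [hΨ, h1, h2, h3]

/-- The depth of the dyadic ladder: some `J` has `(49g/225)(J+1)·3/(2048π²) ≥ 8`. -/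
theorem exists_cooper_depth {g : ℝ} (hg : 0 < g) :
    ∃ J : ℕ, 8 ≤ 49 * g / 225 * ((J + 1) * (3 / (2048 * π ^ 2))) := by
  set z : ℝ := 8 * 225 * 2048 * π ^ 2 / (147 * g) with hz
  refine ⟨⌈z⌉₊, ?_⟩
  have hJz : z ≤ ⌈z⌉₊ := Nat.le_ceil z
  have e : 49 * g / 225 * (z * (3 / (2048 * π ^ 2))) = 8 := by
    rw [hz]
    field_simp
    ring
  have h2 : 49 * g / 225 * (z * (3 / (2048 * π ^ 2))) ≤
      49 * g / 225 * ((⌈z⌉₊ + 1) * (3 / (2048 * π ^ 2))) := by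
    apply mul_le_mul_of_nonneg_left _ (by positivity)
    apply mul_le_mul_of_nonneg_right _ (by positivity)
    linarith
  linarith

/-- The side conditions of Theorem 29 hold for every side above the explicit threshold
`4/(1-2δ) + 64π + (128π/3)4^J + 32768π²4^J + 3`. -/
theorem cooper_side_conditions {δ : ℝ} (hδ' : 0 < 1 - 2 * δ) (J m : ℕ)
    (hL : 4 / (1 - 2 * δ) + 64 * π + 128 * π / 3 * 4 ^ J + 32768 * π ^ 2 * 4 ^ J + 3 ≤
      (m : ℝ) + 1) :
    3 ≤ m + 1 ∧ 4 / (1 - 2 * δ) ≤ ((m + 1 : ℕ) : ℝ) ^ 2 ∧ 64 * π ≤ ((m + 1 : ℕ) : ℝ) ∧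
      64 * π / 3 * 4 ^ J ≤ 1 / 2 * ((m + 1 : ℕ) : ℝ) ∧
      48 * 4 ^ J < 3 / (2048 * π ^ 2) * ((m + 1 : ℕ) : ℝ) ^ 2 := by
  have hc1 : ((m + 1 : ℕ) : ℝ) = (m : ℝ) + 1 := by push_cast; ring
  have hp1 : 0 < 4 / (1 - 2 * δ) := by positivity
  have hp2 : 0 < 64 * π := by positivity
  have hp3 : 0 ≤ 128 * π / 3 * (4 : ℝ) ^ J := by positivity
  have hp4 : 0 ≤ 32768 * π ^ 2 * (4 : ℝ) ^ J := by positivity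
  have hm0 : (0 : ℝ) ≤ m := Nat.cast_nonneg m
  have hLsq : ((m + 1 : ℕ) : ℝ) ≤ ((m + 1 : ℕ) : ℝ) ^ 2 := by
    rw [hc1]
    nlinarith [hm0]
  refine ⟨?_, ?_, ?_, ?_, ?_⟩
  · have h : ((3 : ℕ) : ℝ) ≤ ((m + 1 : ℕ) : ℝ) := by rw [hc1]; push_cast; linarith
    exact_mod_cast h
  · refine le_trans ?_ hLsq
    rw [hc1]
    linarith
  · rw [hc1]; linarith
  · rw [hc1]; linarith
  · have hc : (0 : ℝ) < 3 / (2048 * π ^ 2) := by positivity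
    have h1 : 32768 * π ^ 2 * 4 ^ J < ((m + 1 : ℕ) : ℝ) := by rw [hc1]; linarith
    have h2 : 3 / (2048 * π ^ 2) * (32768 * π ^ 2 * (4 : ℝ) ^ J) = 48 * 4 ^ J := by
      field_simp
      ring
    have h3 := mul_lt_mul_of_pos_left h1 hc
    rw [h2] at h3
    exact h3.trans_le (mul_le_mul_of_nonneg_left hLsq hc.le)

/-- **Theorem 30⁺, quantitative form (order density with the BCS rate).** For every
`δ ∈ (0,1/2)` and `g > 0` there are `U₀ > 0` (`= 3(J+1)/(2048π²16^J)`) and `L₁` such that for all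
`0 ≤ U ≤ U₀` and all even `L ≥ L₁`, every normalised ground state `φ` of
`H_U(L) - (g/L²)Δ_dᴴΔ_d` in the summit's sector has `re ⟨φ, Δ_dᴴΔ_d φ⟩ ≥ (U₀/g) · L⁴`.
[this work] -/
theorem weak_coupling_crutch_order_ge {δ : ℝ} (hδ0 : 0 < δ) (hδ1 : δ < 1 / 2) {g : ℝ}
    (hg : 0 < g) :
    ∃ U₀ : ℝ, 0 < U₀ ∧ ∃ L₁ : ℕ, ∀ U : ℝ, 0 ≤ U → U ≤ U₀ → ∀ n : ℕ, Even (n + 1) → L₁ ≤ n + 1 →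
      ∀ φ : Fock (Orb (FermionTorus 2 (n + 1))), star φ ⬝ᵥ φ = 1 →
        IsGroundStateInSector
          (hubbardTorus 2 (n + 1) 1 U + ((-(g / ((n + 1 : ℕ) : ℝ) ^ 2) : ℝ) : ℂ) •
            ((pairField dWaveFormFactor (n + 1))ᴴ * pairField dWaveFormFactor (n + 1)))
          (2 * ⌊(1 - δ) * ((n + 1 : ℕ) : ℝ) ^ 2 / 2⌋₊) 0 φ →
        U₀ / g * ((n + 1 : ℕ) : ℝ) ^ 4 ≤
          (star φ ⬝ᵥ ((pairField dWaveFormFactor (n + 1))ᴴ * pairField dWaveFormFactor (n + 1))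
            *ᵥ φ).re := by
  obtain ⟨J, hJ8⟩ := exists_cooper_depth hg
  have hδ' : 0 < 1 - 2 * δ := by linarith
  obtain ⟨L₁, hL₁⟩ : ∃ L₁ : ℕ,
      4 / (1 - 2 * δ) + 64 * π + 128 * π / 3 * 4 ^ J + 32768 * π ^ 2 * 4 ^ J + 3 ≤ L₁ :=
    ⟨_, Nat.le_ceil _⟩
  refine ⟨3 * ((J : ℝ) + 1) / (2048 * π ^ 2 * 16 ^ J), by positivity, L₁, ?_⟩
  intro U hU0 hU m hm hmL φ hφ1 hφ
  have hc1 : ((m + 1 : ℕ) : ℝ) = (m : ℝ) + 1 := by push_cast; ring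
  have hL : 4 / (1 - 2 * δ) + 64 * π + 128 * π / 3 * 4 ^ J + 32768 * π ^ 2 * 4 ^ J + 3 ≤
      (m : ℝ) + 1 := by
    have h := hL₁.trans (show (L₁ : ℝ) ≤ ((m + 1 : ℕ) : ℝ) by exact_mod_cast hmL)
    rwa [hc1] at h
  obtain ⟨hL3, hLδ, hL1, hL2, hL4⟩ := cooper_side_conditions hδ' J m hL
  obtain ⟨Ψ, hΨK, hΨ0, hΨ⟩ :=
    exists_cooper_trial_weak hL3 hm hδ0 hδ1 hLδ J hg hL1 hL2 hL4 hJ8 hU0 hU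
  have hL0 : ((m + 1 : ℕ) : ℝ) ≠ 0 := by positivity
  have e : g / ((m + 1 : ℕ) : ℝ) ^ 2 *
      (3 * ((J : ℝ) + 1) / (2048 * π ^ 2 * 16 ^ J) / g * ((m + 1 : ℕ) : ℝ) ^ 4) =
      3 * ((J : ℝ) + 1) / (2048 * π ^ 2 * 16 ^ J) * ((m + 1 : ℕ) : ℝ) ^ 2 := by
    field_simp
  rw [← e] at hΨ
  exact crutch_groundState_order_ge_of_trial U _ (by positivity) hΨK hΨ0 hΨ hφ1 hφ

/-- **Theorem 30⁺ (`d`-wave LRO for the weakly repulsive crutched Hubbard model).** For every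
`δ ∈ (0,1/2)` and `g > 0` there is `U₀ > 0` such that for all `0 ≤ U ≤ U₀`, every family of
normalised sector ground states of `H_U(L) - (g/L²)Δ_dᴴΔ_d` has `d`-wave pair long-range order in
the summit's sense. [this work] -/
theorem weak_coupling_crutch_hasLongRangeOrder {δ : ℝ} (hδ0 : 0 < δ) (hδ1 : δ < 1 / 2) {g : ℝ}
    (hg : 0 < g) :
    ∃ U₀ : ℝ, 0 < U₀ ∧ ∀ U : ℝ, 0 ≤ U → U ≤ U₀ →
      ∀ ψ : ∀ L, Fock (Orb (FermionTorus 2 L)),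
        (∀ n : ℕ, Even (n + 1) → star (ψ (n + 1)) ⬝ᵥ ψ (n + 1) = 1 ∧
          IsGroundStateInSector
            (hubbardTorus 2 (n + 1) 1 U + ((-(g / ((n + 1 : ℕ) : ℝ) ^ 2) : ℝ) : ℂ) •
              ((pairField dWaveFormFactor (n + 1))ᴴ * pairField dWaveFormFactor (n + 1)))
            (2 * ⌊(1 - δ) * ((n + 1 : ℕ) : ℝ) ^ 2 / 2⌋₊) 0 (ψ (n + 1))) →
        HasLongRangeOrder (fun k => halfOpenBox 2 (2 * k))
          (fun k => torusPullback (pairFieldCorr dWaveFormFactor ψ) (2 * k)) := by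
  obtain ⟨J, hJ8⟩ := exists_cooper_depth hg
  have hδ' : 0 < 1 - 2 * δ := by linarith
  obtain ⟨L₁, hL₁⟩ : ∃ L₁ : ℕ,
      4 / (1 - 2 * δ) + 64 * π + 128 * π / 3 * 4 ^ J + 32768 * π ^ 2 * 4 ^ J + 3 ≤ L₁ :=
    ⟨_, Nat.le_ceil _⟩
  refine ⟨3 * ((J : ℝ) + 1) / (2048 * π ^ 2 * 16 ^ J), by positivity, ?_⟩
  intro U hU0 hU ψ hψ
  refine crutch_hasLongRangeOrder_of_trials U (δ := δ)
    (κ := 3 * ((J : ℝ) + 1) / (2048 * π ^ 2 * 16 ^ J)) hg (by positivity) (L₁ := L₁) ?_ ψ hψ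
  intro m hm hmL
  have hc1 : ((m + 1 : ℕ) : ℝ) = (m : ℝ) + 1 := by push_cast; ring
  have hL : 4 / (1 - 2 * δ) + 64 * π + 128 * π / 3 * 4 ^ J + 32768 * π ^ 2 * 4 ^ J + 3 ≤
      (m : ℝ) + 1 := by
    have h := hL₁.trans (show (L₁ : ℝ) ≤ ((m + 1 : ℕ) : ℝ) by exact_mod_cast hmL)
    rwa [hc1] at h
  obtain ⟨hL3, hLδ, hL1, hL2, hL4⟩ := cooper_side_conditions hδ' J m hL
  exact exists_cooper_trial_weak hL3 hm hδ0 hδ1 hLδ J hg hL1 hL2 hL4 hJ8 hU0 hU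

/-- **Theorem 30 (`d`-wave LRO at the free end of the crutch axis).** For every `δ ∈ (0,1/2)` and
`g > 0`, every family of normalised sector ground states of `H₀(L) - (g/L²)Δ_dᴴΔ_d` has `d`-wave
pair long-range order in the summit's sense (claim C53). [this work] -/
theorem free_crutch_hasLongRangeOrder {δ : ℝ} (hδ0 : 0 < δ) (hδ1 : δ < 1 / 2) {g : ℝ}
    (hg : 0 < g) (ψ : ∀ L, Fock (Orb (FermionTorus 2 L)))
    (hψ : ∀ n : ℕ, Even (n + 1) → star (ψ (n + 1)) ⬝ᵥ ψ (n + 1) = 1 ∧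
      IsGroundStateInSector
        (hubbardTorus 2 (n + 1) 1 0 + ((-(g / ((n + 1 : ℕ) : ℝ) ^ 2) : ℝ) : ℂ) •
          ((pairField dWaveFormFactor (n + 1))ᴴ * pairField dWaveFormFactor (n + 1)))
        (2 * ⌊(1 - δ) * ((n + 1 : ℕ) : ℝ) ^ 2 / 2⌋₊) 0 (ψ (n + 1))) :
    HasLongRangeOrder (fun k => halfOpenBox 2 (2 * k))
      (fun k => torusPullback (pairFieldCorr dWaveFormFactor ψ) (2 * k)) := by
  obtain ⟨U₀, hU₀, h⟩ := weak_coupling_crutch_hasLongRangeOrder hδ0 hδ1 hg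
  exact h 0 le_rfl hU₀.le ψ hψ

end Summit.HubbardSuperconductivity.HubbardSuperconductivity.Theorems.CooperPairing
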